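import Literature.Topology.FourManifolds.LeftHandDiscSlab
import Literature.AlgebraicTopology.FundamentalGroup.ArcLevelsMonotone
import HarnessLib

/-!
# Levels along an arc parametrising a left-hand disc of an index-`1` critical point

Topic `Literature/Topology/FourManifolds` (fact seat
`provefact-Literature.Topology.FourManifolds.lauden-f709dd520c`, Laudenbach–Poénaru's Lemma 2:
the free generator `x_q` of `π₁` of a `1`-handlebody attached to the `1`-handle of the critical
point `q` is the class of a loop running along an arc `C` onto the left-hand disc `D_L(q)`
(`OneHandlebodyArcsExposed.lean`, `BallWithArcsBasis.lean`); to read off the effect of a handle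
slide on it the loop is cut at the two points of `D_L(q)` on the level of the feet of the
handle, which requires the levels to be monotone along each half of the arc).  Everything here
is **proved**; no named facts.

In Milnor's setting `Cobordism.LeftSphereSetting` (`LeftHandSphereFlow.lean`: the slab flow `θ`
of the cut-off gradient-like field, a Milnor box about the critical point `q`, a lower level
`b`):

* `LeftSphereSetting.orbitClosure S y = {θ (t, y) | t ≥ 0} ∪ {q}` — for `y ∈ D_L(q) = leftHandDisc f ξ q b`
  a preconnected subset of `D_L(q)` through `y` and `q` (the trajectory of `y` goes to `q`,
  Def. 3.9; `isPreconnected_orbitClosure`, `orbitClosure_subset_leftHandDisc`);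
* along it **every function `g` which the cut-off field does not decrease and strictly
  increases at `y`** is `> g y` off `y` (`lt_of_mem_orbitClosure`) — in particular `f` itself
  (`apply_lt_of_mem_orbitClosure`), but also any other function having `ξ` as a gradient-like
  field near `D_L(q)` (the rearranged Morse functions of Milnor's §4 share the field);
* hence (`ArcLevelsMonotone.lean`) for an injective path `C` with `range C = D_L(q)` and
  `C s_q = q`: **`g ∘ C` is strictly increasing on `[0, s_q]` and strictly decreasing on
  `[s_q, 1]`** (`strictMonoOn_comp_arc`, `strictAntiOn_comp_arc`), and the critical parameter
  `s_q` exists and is unique (`existsUnique_apply_eq_q`).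

## References

* J. Milnor, *Lectures on the h-cobordism theorem* (1965), Def. 3.1 (1) (PDF p. 12), Def. 3.9
  (PDF p. 16). [MilnorHCobordism1965]
* F. Laudenbach, V. Poénaru, *A note on 4-dimensional handlebodies*, Bull. Soc. Math. France
  100 (1972), p. 339 (the basis `x₁, …, x_p` from the spines of the `1`-handles).
  [LaudenbachPoenaruBSMF1972]
-/

open scoped Manifold ContDiff Topology unitInterval
open Set Function Filter Metric

noncomputable section

namespace Literature.Topology.FourManifolds

universe u

variable {n : ℕ} {M N : Type u} [TopologicalSpace M] [ChartedSpace (EuclideanSpace ℝ (Fin n)) M]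
  [TopologicalSpace N] [ChartedSpace (EuclideanSpace ℝ (Fin n)) N]

namespace Cobordism

namespace LeftSphereSetting

open FourManifolds.Flow Literature.AlgebraicTopology.FundamentalGroup

variable {c : Cobordism n M N} {f : c.W → ℝ} {ξ : Π x : c.W, TangentSpace (𝓡∂ (n + 1)) x}
  {k : ℕ} (S : LeftSphereSetting c f ξ k)

/-! ### The closure of a forward trajectory going to `q` -/

/-- **The forward trajectory of `y` with its limit `q` adjoined**: `{θ (t, y) | t ≥ 0} ∪ {q}`.
[cite: MilnorHCobordism1965, Def. 3.9 (PDF p. 16)] -/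
def orbitClosure (y : c.W) : Set c.W := (fun t : ℝ => S.θ (t, y)) '' Ici 0 ∪ {S.q}

/-- `y` lies on it. [folklore] -/
theorem mem_orbitClosure_self (y : c.W) : y ∈ S.orbitClosure y :=
  Or.inl ⟨0, self_mem_Ici, S.isSmoothFlow.map_zero y⟩

/-- `q` lies on it. [folklore] -/
theorem q_mem_orbitClosure (y : c.W) : S.q ∈ S.orbitClosure y := Or.inr rfl

/-- `q` lies on its own stable set. [cite: MilnorHCobordism1965, Def. 3.9 (PDF p. 16)] -/
theorem q_mem_stableSet : S.q ∈ stableSet (𝓡∂ (n + 1)) ξ S.q := by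
  have h := S.discPoint_mem_stableSet (v := 0) (by simp)
  rwa [S.discPoint_zero] at h

/-- A point of the left-hand disc lies above `a₀`. [folklore] -/
theorem a₀_le_of_mem_leftHandDisc {y : c.W} (hy : y ∈ leftHandDisc (𝓡∂ (n + 1)) f ξ S.q S.b) : S.a₀ ≤ f y :=
  S.lt_b.le.trans ((mem_leftHandDisc_iff.1 hy).2)

/-- **For `y` on the left-hand disc the set is a preconnected** (the forward trajectory is
connected and converges to `q`). [cite: MilnorHCobordism1965, Def. 3.9 (PDF p. 16)] -/
theorem isPreconnected_orbitClosure {y : c.W} (hy : y ∈ leftHandDisc (𝓡∂ (n + 1)) f ξ S.q S.b) :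
    IsPreconnected (S.orbitClosure y) := by
  have hcont : Continuous fun t : ℝ => S.θ (t, y) :=
    S.isSmoothFlow.contMDiff.continuous.comp (continuous_id.prodMk continuous_const)
  have hA : IsPreconnected ((fun t : ℝ => S.θ (t, y)) '' Ici 0) :=
    isPreconnected_Ici.image _ hcont.continuousOn
  refine hA.subset_closure subset_union_left (union_subset subset_closure ?_)
  -- `q` is the limit of the trajectory
  rw [singleton_subset_iff]
  have hlim := S.tendsto_of_mem_stableSet (mem_leftHandDisc_iff.1 hy).1 (S.a₀_le_of_mem_leftHandDisc hy)
  refine mem_closure_of_tendsto hlim (Filter.eventually_atTop.2 ⟨0, fun t ht => ⟨t, ht, rfl⟩⟩)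

/-- **The set lies in the left-hand disc** (forward invariance of the stable set, `f`
non-decreasing along the flow). [cite: MilnorHCobordism1965, Def. 3.9 (PDF p. 16)] -/
theorem orbitClosure_subset_leftHandDisc {y : c.W} (hy : y ∈ leftHandDisc (𝓡∂ (n + 1)) f ξ S.q S.b) :
    S.orbitClosure y ⊆ leftHandDisc (𝓡∂ (n + 1)) f ξ S.q S.b := by
  have hy' := mem_leftHandDisc_iff.1 hy
  have hya : S.a₀ ≤ f y := S.a₀_le_of_mem_leftHandDisc hy
  rintro z (⟨t, ht, rfl⟩ | rfl)
  · have hta : S.a₀ ≤ f (S.θ (t, y)) := S.pre.le_apply_of_nonneg hya ht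
    refine mem_leftHandDisc_iff.2 ⟨(S.pre.apply_mem_stableSet_iff hya hta S.apply_le).2 hy'.1, ?_⟩
    have hmono := S.pre.monotone y ht
    simp only [S.isSmoothFlow.map_zero] at hmono
    exact hy'.2.trans hmono
  · exact mem_leftHandDisc_iff.2 ⟨S.q_mem_stableSet, (by linarith [S.b_lt, sq_nonneg S.box.ε] : S.b ≤ f S.q)⟩

/-- **Along the set, a function not decreased by the cut-off field and strictly increased at
`y` exceeds its value at `y`, off `y`.**  (At `q`, the limit, the value is at least the values
along the trajectory, which already exceed `g y`.) [cite: MilnorHCobordism1965, Def. 3.1 (1) (PDF p. 12), proof of Thm. 3.4] -/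
theorem lt_of_mem_orbitClosure {y : c.W} (hy : y ∈ leftHandDisc (𝓡∂ (n + 1)) f ξ S.q S.b)
    {g : c.W → ℝ} (hg : ContMDiff (𝓡∂ (n + 1)) 𝓘(ℝ, ℝ) ∞ g)
    (hnn : ∀ z, 0 ≤ mlineDeriv (𝓡∂ (n + 1)) g z (slabField f ξ S.a₀ S.a₁ z))
    (hpos : 0 < mlineDeriv (𝓡∂ (n + 1)) g y (slabField f ξ S.a₀ S.a₁ y))
    {z : c.W} (hz : z ∈ S.orbitClosure y) (hzy : z ≠ y) : g y < g z := by
  have hflow := S.isSmoothFlow.isFlowOf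
  have hpos0 : 0 < mlineDeriv (𝓡∂ (n + 1)) g (S.θ (0, y)) (slabField f ξ S.a₀ S.a₁ (S.θ (0, y))) := by
    rwa [S.isSmoothFlow.map_zero]
  have hlt : ∀ t : ℝ, 0 < t → g y < g (S.θ (t, y)) := fun t ht => by
    have h := hflow.apply_lt_apply_of_pos hg hnn hpos0 ht
    rwa [S.isSmoothFlow.map_zero] at h
  rcases hz with ⟨t, ht, rfl⟩ | rfl
  · rcases (mem_Ici.1 ht).eq_or_lt with rfl | ht'
    · exact absurd (S.isSmoothFlow.map_zero y) hzy
    · exact hlt t ht'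
  · -- `z = q`: pass to the limit along the trajectory
    have hya : S.a₀ ≤ f y := S.a₀_le_of_mem_leftHandDisc hy
    have hlim := S.tendsto_of_mem_stableSet (mem_leftHandDisc_iff.1 hy).1 hya
    have hglim : Tendsto (fun t => g (S.θ (t, y))) atTop (𝓝 (g S.q)) := hg.continuous.continuousAt.tendsto.comp hlim
    have h1 : g y < g (S.θ (1, y)) := hlt 1 one_pos
    have hmono : ∀ t : ℝ, 1 ≤ t → g (S.θ (1, y)) ≤ g (S.θ (t, y)) := fun t ht => by
      rcases ht.eq_or_lt with rfl | ht'
      · exact le_rfl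
      · have hpos1 : 0 ≤ mlineDeriv (𝓡∂ (n + 1)) g (S.θ (1, y)) (slabField f ξ S.a₀ S.a₁ (S.θ (1, y))) := hnn _
        rcases hpos1.eq_or_lt with h0 | hp
        · -- monotone anyway
          exact (hflow.monotone_apply (hg.mdifferentiable (by simp)) hnn y) ht
        · exact (hflow.apply_lt_apply_of_pos hg hnn hp ht').le
    have h2 : g (S.θ (1, y)) ≤ g S.q :=
      ge_of_tendsto hglim (Filter.eventually_atTop.2 ⟨1, hmono⟩)
    exact lt_of_lt_of_le h1 h2

/-- **`f` itself exceeds `f y` along the set, off `y`** (`y ≠ q` a point of the left-hand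
disc). [cite: MilnorHCobordism1965, Def. 3.1 (1) (PDF p. 12), Def. 3.9 (PDF p. 16)] -/
theorem apply_lt_of_mem_orbitClosure {y : c.W} (hy : y ∈ leftHandDisc (𝓡∂ (n + 1)) f ξ S.q S.b)
    (hyq : y ≠ S.q) {z : c.W} (hz : z ∈ S.orbitClosure y) (hzy : z ≠ y) : f y < f z :=
  S.lt_of_mem_orbitClosure hy S.contMDiff_f S.pre.mlineDeriv_slabField_nonneg
    (S.mlineDeriv_pos_of_mem_stableSet (mem_leftHandDisc_iff.1 hy).1 hyq (S.a₀_le_of_mem_leftHandDisc hy)) hz hzy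

/-- **Positivity of the cut-off field on a second function.**  If `ξ(g) > 0` off the critical
points of `f` and `ξ(g) ≥ 0` everywhere (as when `ξ` is gradient-like for a function `g` with
the same critical points), then the cut-off field does not decrease `g`, and increases it
strictly at every point `y ≠ q` of the left-hand disc. [cite: MilnorHCobordism1965, Def. 3.1 (1) (PDF p. 12), §4 (PDF p. 22)] -/
theorem slabField_hyps {g : c.W → ℝ} (hnn : ∀ z, 0 ≤ mlineDeriv (𝓡∂ (n + 1)) g z (ξ z))
    (hpos : ∀ z, ¬ IsMCriticalPt (𝓡∂ (n + 1)) f z → 0 < mlineDeriv (𝓡∂ (n + 1)) g z (ξ z)) :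
    (∀ z, 0 ≤ mlineDeriv (𝓡∂ (n + 1)) g z (slabField f ξ S.a₀ S.a₁ z)) ∧
      ∀ y ∈ leftHandDisc (𝓡∂ (n + 1)) f ξ S.q S.b, y ≠ S.q →
        0 < mlineDeriv (𝓡∂ (n + 1)) g y (slabField f ξ S.a₀ S.a₁ y) := by
  refine ⟨fun z => ?_, fun y hy hyq => ?_⟩
  · rw [slabField_apply, mlineDeriv_smul]
    exact mul_nonneg (slabCutoff_nonneg _ _ _) (hnn z)
  · have hya : S.a₀ ≤ f y := S.a₀_le_of_mem_leftHandDisc hy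
    have hy1 : f y ≤ S.a₁ := (S.apply_le_of_mem_stableSet (mem_leftHandDisc_iff.1 hy).1).trans S.apply_le
    rw [S.pre.slabField_eq ⟨hya, hy1⟩]
    exact hpos y (S.not_isMCriticalPt_of_mem_stableSet (mem_leftHandDisc_iff.1 hy).1 hyq)

/-! ### Arcs onto the left-hand disc -/

variable {e₀ e₁ : c.W} (C : Path e₀ e₁) (hC : Injective C) (hrange : range C = leftHandDisc (𝓡∂ (n + 1)) f ξ S.q S.b)

include hC hrange in
/-- **The critical parameter**: there is a unique `s_q` with `C s_q = q`. [cite: MilnorHCobordism1965, Def. 3.9 (PDF p. 16)] -/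
theorem existsUnique_apply_eq_q : ∃! s_q : I, C s_q = S.q := by
  have hq : S.q ∈ range C := by
    rw [hrange]
    exact mem_leftHandDisc_iff.2 ⟨S.q_mem_stableSet, (by linarith [S.b_lt, sq_nonneg S.box.ε] : S.b ≤ f S.q)⟩
  obtain ⟨s_q, hs_q⟩ := hq
  exact ⟨s_q, hs_q, fun s hs => hC (hs.trans hs_q.symm)⟩

include hC hrange in
/-- The hypothesis of `ArcLevelsMonotone.lean` for a function `g` not decreased by the cut-off
field and strictly increased at the points `≠ q` of the left-hand disc. [cite: MilnorHCobordism1965, Def. 3.9 (PDF p. 16)] -/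
theorem arc_hyp {g : c.W → ℝ} (hg : ContMDiff (𝓡∂ (n + 1)) 𝓘(ℝ, ℝ) ∞ g)
    (hnn : ∀ z, 0 ≤ mlineDeriv (𝓡∂ (n + 1)) g z (slabField f ξ S.a₀ S.a₁ z))
    (hpos : ∀ y ∈ leftHandDisc (𝓡∂ (n + 1)) f ξ S.q S.b, y ≠ S.q →
      0 < mlineDeriv (𝓡∂ (n + 1)) g y (slabField f ξ S.a₀ S.a₁ y))
    {s_q : I} (hs_q : C s_q = S.q) (s : I) (hs : s ≠ s_q) :
    ∃ Γ ⊆ range C, IsPreconnected Γ ∧ C s ∈ Γ ∧ C s_q ∈ Γ ∧ ∀ z ∈ Γ, z ≠ C s → g (C s) < g z := by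
  have hy : C s ∈ leftHandDisc (𝓡∂ (n + 1)) f ξ S.q S.b := by rw [← hrange]; exact mem_range_self s
  have hyq : C s ≠ S.q := fun h => hs (hC (h.trans hs_q.symm))
  refine ⟨S.orbitClosure (C s), by rw [hrange]; exact S.orbitClosure_subset_leftHandDisc hy,
    S.isPreconnected_orbitClosure hy, S.mem_orbitClosure_self _, by rw [hs_q]; exact S.q_mem_orbitClosure _,
    fun z hz hzy => S.lt_of_mem_orbitClosure hy hg hnn (hpos _ hy hyq) hz hzy⟩

include hC hrange in
/-- **`g ∘ C` is strictly increasing on `[0, s_q]`** for every smooth `g` which the cut-off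
field does not decrease and strictly increases at the points `≠ q` of the left-hand disc.
[cite: MilnorHCobordism1965, Def. 3.1 (1) (PDF p. 12), Def. 3.9 (PDF p. 16)] -/
theorem strictMonoOn_comp_arc {g : c.W → ℝ} (hg : ContMDiff (𝓡∂ (n + 1)) 𝓘(ℝ, ℝ) ∞ g)
    (hnn : ∀ z, 0 ≤ mlineDeriv (𝓡∂ (n + 1)) g z (slabField f ξ S.a₀ S.a₁ z))
    (hpos : ∀ y ∈ leftHandDisc (𝓡∂ (n + 1)) f ξ S.q S.b, y ≠ S.q →
      0 < mlineDeriv (𝓡∂ (n + 1)) g y (slabField f ξ S.a₀ S.a₁ y))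
    {s_q : I} (hs_q : C s_q = S.q) : StrictMonoOn (g ∘ C) {s | s ≤ s_q} :=
  ArcLevels.strictMonoOn_comp C hC g fun s hs => S.arc_hyp C hC hrange hg hnn hpos hs_q s (ne_of_lt hs)

include hC hrange in
/-- **`g ∘ C` is strictly decreasing on `[s_q, 1]`** for every such `g`. [cite: MilnorHCobordism1965, Def. 3.1 (1) (PDF p. 12), Def. 3.9 (PDF p. 16)] -/
theorem strictAntiOn_comp_arc {g : c.W → ℝ} (hg : ContMDiff (𝓡∂ (n + 1)) 𝓘(ℝ, ℝ) ∞ g)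
    (hnn : ∀ z, 0 ≤ mlineDeriv (𝓡∂ (n + 1)) g z (slabField f ξ S.a₀ S.a₁ z))
    (hpos : ∀ y ∈ leftHandDisc (𝓡∂ (n + 1)) f ξ S.q S.b, y ≠ S.q →
      0 < mlineDeriv (𝓡∂ (n + 1)) g y (slabField f ξ S.a₀ S.a₁ y))
    {s_q : I} (hs_q : C s_q = S.q) : StrictAntiOn (g ∘ C) {s | s_q ≤ s} :=
  ArcLevels.strictAntiOn_comp C hC g fun s hs => S.arc_hyp C hC hrange hg hnn hpos hs_q s (ne_of_gt hs)

include hC hrange in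
/-- **The levels of `f` along the arc**: `f ∘ C` is strictly increasing on `[0, s_q]` and
strictly decreasing on `[s_q, 1]`. [cite: MilnorHCobordism1965, Def. 3.1 (1) (PDF p. 12), Def. 3.9 (PDF p. 16)] -/
theorem strictMonoOn_and_strictAntiOn_apply_arc {s_q : I} (hs_q : C s_q = S.q) :
    StrictMonoOn (f ∘ C) {s | s ≤ s_q} ∧ StrictAntiOn (f ∘ C) {s | s_q ≤ s} :=
  ⟨S.strictMonoOn_comp_arc C hC hrange S.contMDiff_f S.pre.mlineDeriv_slabField_nonneg
      (fun _ hy hyq => S.mlineDeriv_pos_of_mem_stableSet (mem_leftHandDisc_iff.1 hy).1 hyq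
        (S.a₀_le_of_mem_leftHandDisc hy)) hs_q,
    S.strictAntiOn_comp_arc C hC hrange S.contMDiff_f S.pre.mlineDeriv_slabField_nonneg
      (fun _ hy hyq => S.mlineDeriv_pos_of_mem_stableSet (mem_leftHandDisc_iff.1 hy).1 hyq
        (S.a₀_le_of_mem_leftHandDisc hy)) hs_q⟩

include hC hrange in
/-- **The levels along the arc of a second function with the same gradient-like field**: if
`ξ(g) ≥ 0` everywhere and `ξ(g) > 0` off the critical points of `f`, then `g ∘ C` is strictly
increasing on `[0, s_q]` and strictly decreasing on `[s_q, 1]`. [cite: MilnorHCobordism1965, Def. 3.1 (1) (PDF p. 12), §4 (PDF p. 22)] -/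
theorem strictMonoOn_and_strictAntiOn_comp_arc {g : c.W → ℝ} (hg : ContMDiff (𝓡∂ (n + 1)) 𝓘(ℝ, ℝ) ∞ g)
    (hnn : ∀ z, 0 ≤ mlineDeriv (𝓡∂ (n + 1)) g z (ξ z))
    (hpos : ∀ z, ¬ IsMCriticalPt (𝓡∂ (n + 1)) f z → 0 < mlineDeriv (𝓡∂ (n + 1)) g z (ξ z))
    {s_q : I} (hs_q : C s_q = S.q) :
    StrictMonoOn (g ∘ C) {s | s ≤ s_q} ∧ StrictAntiOn (g ∘ C) {s | s_q ≤ s} :=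
  ⟨S.strictMonoOn_comp_arc C hC hrange hg (S.slabField_hyps hnn hpos).1 (S.slabField_hyps hnn hpos).2 hs_q,
    S.strictAntiOn_comp_arc C hC hrange hg (S.slabField_hyps hnn hpos).1 (S.slabField_hyps hnn hpos).2 hs_q⟩

/-! ### The two sides of a level -/

include hC hrange in
/-- **The parameters at which the arc is at or below a level.**  Let `g` be as above,
`s₁ ≤ s_q ≤ s₂` parameters with `g (C s₁) = g (C s₂) = ℓ`.  Then `g (C s) ≤ ℓ` iff
`s ≤ s₁ ∨ s₂ ≤ s`, and `ℓ ≤ g (C s)` iff `s₁ ≤ s ≤ s₂`... precisely: for every `s`,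
`g (C s) ≤ ℓ ↔ (s ≤ s₁ ∨ s₂ ≤ s)`. [cite: MilnorHCobordism1965, Def. 3.9 (PDF p. 16)] -/
theorem apply_arc_le_iff {g : c.W → ℝ} (hg : ContMDiff (𝓡∂ (n + 1)) 𝓘(ℝ, ℝ) ∞ g)
    (hnn : ∀ z, 0 ≤ mlineDeriv (𝓡∂ (n + 1)) g z (slabField f ξ S.a₀ S.a₁ z))
    (hpos : ∀ y ∈ leftHandDisc (𝓡∂ (n + 1)) f ξ S.q S.b, y ≠ S.q →
      0 < mlineDeriv (𝓡∂ (n + 1)) g y (slabField f ξ S.a₀ S.a₁ y))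
    {s_q : I} (hs_q : C s_q = S.q) {s₁ s₂ : I} (h₁ : s₁ ≤ s_q) (h₂ : s_q ≤ s₂) {ℓ : ℝ}
    (hℓ₁ : g (C s₁) = ℓ) (hℓ₂ : g (C s₂) = ℓ) (s : I) :
    g (C s) ≤ ℓ ↔ s ≤ s₁ ∨ s₂ ≤ s := by
  rcases le_total s s_q with hs | hs
  · rw [ArcLevels.apply_le_iff_le_of_le C hC g (fun s hs => S.arc_hyp C hC hrange hg hnn hpos hs_q s (ne_of_lt hs))
      h₁ hℓ₁ hs]
    constructor
    · exact Or.inl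
    · rintro (h | h)
      · exact h
      · -- `s₂ ≤ s ≤ s_q ≤ s₂` forces `s = s_q = s₂`, and then `g (C s) = ℓ`... via `s ≤ s₁`? use values
        have hs2 : s = s₂ := le_antisymm (hs.trans h₂) h
        subst hs2
        have hsq : s = s_q := le_antisymm hs h₂
        subst hsq
        -- now `g (C s) = ℓ = g (C s₁)` with `s₁ ≤ s`; strict monotonicity gives `s₁ = s`
        by_contra hlt
        have hm := ArcLevels.strictMonoOn_comp C hC g (fun s' hs' => S.arc_hyp C hC hrange hg hnn hpos hs_q s' (ne_of_lt hs'))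
        have := hm (show s₁ ∈ {s' | s' ≤ s} from h₁) (show s ∈ {s' | s' ≤ s} by show s ≤ s; exact le_rfl) (lt_of_not_ge hlt)
        simp only [comp_apply, hℓ₁, hℓ₂, lt_self_iff_false] at this
  · rw [ArcLevels.apply_le_iff_le_of_ge C hC g (fun s hs => S.arc_hyp C hC hrange hg hnn hpos hs_q s (ne_of_gt hs))
      h₂ hℓ₂ hs]
    constructor
    · exact Or.inr
    · rintro (h | h)
      · have hs1 : s = s₁ := le_antisymm h (h₁.trans hs)
        subst hs1
        have hsq : s = s_q := le_antisymm h₁ hs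
        subst hsq
        by_contra hlt
        have hm := ArcLevels.strictAntiOn_comp C hC g (fun s' hs' => S.arc_hyp C hC hrange hg hnn hpos hs_q s' (ne_of_gt hs'))
        have := hm (show s ∈ {s' | s ≤ s'} by show s ≤ s; exact le_rfl) (show s₂ ∈ {s' | s ≤ s'} from h₂) (lt_of_not_ge hlt)
        simp only [comp_apply, hℓ₁, hℓ₂, lt_self_iff_false] at this
      · exact h

end LeftSphereSetting

end Cobordism

end Literature.Topology.FourManifolds
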